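import Summits.Ventures.PercRepro.Night2T3Planes4
import Summits.Ventures.PercRepro.Night2T3Chebyshev

/-!
# PercRepro — the type-`3` balance when every plane has `≤ 4` points: corank `≥ 8` (night-2, NIGHT-2-t3.md §7.2)

With `C_j = {S ∈ R_q(G) : |G ∖ S| = j}` and `i_j = #C_j`, the plane bound gives `(d − j + 4)·i_j ≤ (j + 1)·i_{j+1}`
for `j + 2 ≤ d` and `3·i_{d−1} ≤ d·i_d`: the ratios of `i` dominate those of the profile `T_k = C(d+4, k)` (`k < d`),
`T_d = (3/5)·C(d+4, d)`.  The ratio-profile comparison (`ratio_profile_bound`) with the non-increasing `g(k) = d + 3 − 2k`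
gives `Σ_k i_k g(k) ≤ (Σ i)·σ′_d/(Σ T)` where
`σ′_d = Σ_k T_k g(k) = −2^{d+4} + (2/5)·C(d+4,4)·(d−3) + C(d+4,3)·(d−1) + C(d+4,2)·(d+1) + (d+4)(d+3) + (d+5)`,
which is `≤ 0` for every `d ≥ 8` (`sigma_nonpos`: `−827` at `d = 8`; for `d ≥ 9` the binomial bounds `C(n,k) ≤ n^k/k!`
and the induction `2·R(d) ≥ R(d + 1)`).  Hence the size form is nonnegative and **`0 ≤ J_3(G)` for every rank-`q` set
`G` of a simple matroid with `4 ≤ q`, `|G| ≥ q + 8` and every plane of `G` with `≤ 4` points** — with coranks `≤ 5`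
(Theorem C) and `6`, `7` (`Night2T3Planes4`) this is Theorem G′ in the kernel.  Imports `Night2T3Planes4` and
`Night2T3Chebyshev`.
-/
namespace PercRepro.Star

open Finset ThmH SixFour GenQ

/-! ## The profile sum -/

/-- The crude polynomial majorant of the tail of `σ′`. -/
noncomputable def tailMajorant (d : ℚ) : ℚ :=
  2 / 5 * ((d + 4) ^ 4 / 24) * (d - 3) + ((d + 4) ^ 3 / 6) * (d - 1) + ((d + 4) ^ 2 / 2) * (d + 1) +
    (d + 4) * (d + 3) + (d + 5)

/-- `R(9 + m) ≤ 2^(13 + m)` for every `m`: the base `R(9) < 8192` and the step `R(d + 1) ≤ 2·R(d)`. -/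
theorem tailMajorant_le_two_pow (m : ℕ) : tailMajorant ((9 : ℚ) + m) ≤ (2 : ℚ) ^ (13 + m) := by
  induction m with
  | zero =>
    unfold tailMajorant
    norm_num
  | succ m ih =>
    have hstep : tailMajorant ((9 : ℚ) + (m + 1 : ℕ)) ≤ 2 * tailMajorant ((9 : ℚ) + m) := by
      have hm : (0 : ℚ) ≤ (m : ℚ) := by positivity
      have key : 2 * tailMajorant ((9 : ℚ) + m) - tailMajorant ((9 : ℚ) + (m + 1 : ℕ)) =
          3728 + 10409 / 6 * (m : ℚ) + 3051 / 10 * (m : ℚ) ^ 2 + 386 / 15 * (m : ℚ) ^ 3 +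
            21 / 20 * (m : ℚ) ^ 4 + 1 / 60 * (m : ℚ) ^ 5 := by
        unfold tailMajorant
        push_cast
        ring
      have : (0 : ℚ) ≤ 3728 + 10409 / 6 * (m : ℚ) + 3051 / 10 * (m : ℚ) ^ 2 + 386 / 15 * (m : ℚ) ^ 3 +
          21 / 20 * (m : ℚ) ^ 4 + 1 / 60 * (m : ℚ) ^ 5 := by positivity
      linarith
    calc tailMajorant ((9 : ℚ) + (m + 1 : ℕ)) ≤ 2 * tailMajorant ((9 : ℚ) + m) := hstep
      _ ≤ 2 * (2 : ℚ) ^ (13 + m) := by linarith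
      _ = (2 : ℚ) ^ (13 + (m + 1)) := by ring

/-- **`σ′_d ≤ 0` for `d ≥ 8`.** -/
theorem sigma_nonpos (d : ℕ) (hd : 8 ≤ d) :
    -(2 : ℚ) ^ (d + 4) + 2 / 5 * ((d + 4).choose 4 : ℚ) * ((d : ℚ) - 3) +
        ((d + 4).choose 3 : ℚ) * ((d : ℚ) - 1) + ((d + 4).choose 2 : ℚ) * ((d : ℚ) + 1) +
        ((d : ℚ) + 4) * ((d : ℚ) + 3) + ((d : ℚ) + 5) ≤ 0 := by
  rcases Nat.eq_or_lt_of_le hd with h8 | h9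
  · subst h8
    norm_num [Nat.choose]
  · obtain ⟨m, rfl⟩ : ∃ m, d = 9 + m := ⟨d - 9, by omega⟩
    have c4 : ((9 + m + 4).choose 4 : ℚ) ≤ ((9 + m + 4 : ℕ) : ℚ) ^ 4 / (4 : ℕ).factorial :=
      Nat.choose_le_pow_div 4 (9 + m + 4)
    have c3 : ((9 + m + 4).choose 3 : ℚ) ≤ ((9 + m + 4 : ℕ) : ℚ) ^ 3 / (3 : ℕ).factorial :=
      Nat.choose_le_pow_div 3 (9 + m + 4)
    have c2 : ((9 + m + 4).choose 2 : ℚ) ≤ ((9 + m + 4 : ℕ) : ℚ) ^ 2 / (2 : ℕ).factorial :=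
      Nat.choose_le_pow_div 2 (9 + m + 4)
    have hmaj := tailMajorant_le_two_pow m
    have hd3 : (0 : ℚ) ≤ ((9 + m : ℕ) : ℚ) - 3 := by push_cast; linarith [(by positivity : (0:ℚ) ≤ (m:ℚ))]
    have hd1 : (0 : ℚ) ≤ ((9 + m : ℕ) : ℚ) - 1 := by push_cast; linarith [(by positivity : (0:ℚ) ≤ (m:ℚ))]
    have hdp : (0 : ℚ) ≤ ((9 + m : ℕ) : ℚ) + 1 := by positivity
    have e4 := mul_le_mul_of_nonneg_right c4 hd3
    have e3 := mul_le_mul_of_nonneg_right c3 hd1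
    have e2 := mul_le_mul_of_nonneg_right c2 hdp
    have hpow : (2 : ℚ) ^ (9 + m + 4) = (2 : ℚ) ^ (13 + m) := by
      rw [show 9 + m + 4 = 13 + m by omega]
    unfold tailMajorant at hmaj
    simp only [Nat.factorial] at e4 e3 e2
    push_cast at e4 e3 e2 hmaj ⊢
    rw [hpow]
    nlinarith [e4, e3, e2, hmaj]

variable {α : Type*} [DecidableEq α] {M : Matroid α} [M.Finite]

/-- **Corank `≥ 8` under the plane bound**: `0 ≤ J_3(G)` for `4 ≤ q`, `q + 8 ≤ |G|`, every plane of `G` with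
`≤ 4` points. -/
theorem Jq_three_nonneg_of_planes_of_add_eight_le (hs : Simple M) {G : Finset α} {q : ℕ} (hG : G ⊆ gr M)
    (hrG : M.eRk (G : Set α) = (q : ℕ∞)) (hq : 4 ≤ q)
    (hP : ∀ X ⊆ G, M.eRk (X : Set α) ≤ 3 → X.card ≤ 4) (hcard : q + 8 ≤ G.card) : 0 ≤ Jq M G q 3 := by
  obtain ⟨d, hd⟩ : ∃ d, G.card = q + d := ⟨G.card - q, by omega⟩
  have hd8 : 8 ≤ d := by omega
  obtain ⟨e, rfl⟩ : ∃ e, d = e + 1 := ⟨d - 1, by omega⟩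
  apply Jq_three_nonneg_of_split hs hG hrG (by omega) hd
  set i : ℕ → ℚ := fun j => ((((Rq M G q).filter (fun S : Finset α => (G \ S).card = j)).card : ℕ) : ℚ) with hi_def
  set n := e + 5 with hn
  set T : ℕ → ℚ := fun k => if k ≤ e then (n.choose k : ℚ) else 3 / 5 * (n.choose (e + 1) : ℚ) with hT_def
  set g : ℕ → ℚ := fun k => ((e + 1 : ℕ) : ℚ) + 3 - 2 * (k : ℚ) with hg_def
  -- the size-form sum is `−Σ i g`
  have hsum : ∑ j ∈ Finset.range (e + 1 + 1), i j * (2 * (j : ℚ) - ((e + 1 : ℕ) : ℚ) - 3) =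
      -∑ j ∈ Finset.range (e + 1 + 1), i j * g j := by
    rw [← Finset.sum_neg_distrib]
    apply Finset.sum_congr rfl
    intro j _
    simp only [hg_def]
    ring
  -- positivity of the profile
  have hTpos : ∀ k ∈ Finset.range (e + 1 + 1), 0 < T k := by
    intro k hk
    have hk' := Finset.mem_range.1 hk
    simp only [hT_def]
    split_ifs with h
    · exact_mod_cast Nat.choose_pos (by omega)
    · have : 0 < n.choose (e + 1) := Nat.choose_pos (by omega)
      positivity
  -- the ratio condition
  have hratio : ∀ k, k < e + 1 → i k * T (k + 1) ≤ i (k + 1) * T k := by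
    intro k hk
    have hi0 : (0 : ℚ) ≤ i k := by simp only [hi_def]; positivity
    rcases Nat.lt_or_ge k e with hke | hke
    · -- both binomial: `(k+1)·C(n,k+1) = (n−k)·C(n,k)` and `(d − k + 4)·i_k ≤ (k+1)·i_{k+1}`
      have hT1 : T (k + 1) = (n.choose (k + 1) : ℚ) := by simp only [hT_def]; rw [if_pos (by omega)]
      have hT0 : T k = (n.choose k : ℚ) := by simp only [hT_def]; rw [if_pos (by omega)]
      rw [hT1, hT0]
      have hch := Nat.choose_succ_right_eq n k
      have hch' : (n.choose (k + 1) : ℚ) * ((k : ℚ) + 1) = (n.choose k : ℚ) * ((n - k : ℕ) : ℚ) := by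
        exact_mod_cast hch
      have hL := succ_mul_card_ge_of_planes hs hG hrG hq hP (j := k) (by omega)
      rw [hd, show q + (e + 1) - q - k + 4 = n - k by omega] at hL
      have hL' : ((n - k : ℕ) : ℚ) * i k ≤ ((k : ℚ) + 1) * i (k + 1) := by
        simp only [hi_def]
        exact_mod_cast hL
      have hk1 : (0 : ℚ) < (k : ℚ) + 1 := by positivity
      have hc0 : (0 : ℚ) ≤ (n.choose k : ℚ) := by positivity
      -- multiply the goal by `k + 1 > 0`
      have : i k * (n.choose (k + 1) : ℚ) * ((k : ℚ) + 1) ≤ i (k + 1) * (n.choose k : ℚ) * ((k : ℚ) + 1) := by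
        calc i k * (n.choose (k + 1) : ℚ) * ((k : ℚ) + 1) = i k * ((n.choose k : ℚ) * ((n - k : ℕ) : ℚ)) := by
              rw [mul_assoc, hch']
          _ = (n.choose k : ℚ) * (((n - k : ℕ) : ℚ) * i k) := by ring
          _ ≤ (n.choose k : ℚ) * (((k : ℚ) + 1) * i (k + 1)) := mul_le_mul_of_nonneg_left hL' hc0
          _ = i (k + 1) * (n.choose k : ℚ) * ((k : ℚ) + 1) := by ring
      exact le_of_mul_le_mul_right this hk1
    · -- `k = e`: `T_e = C(n,e)`, `T_{e+1} = (3/5)·C(n, e+1)`, and `3·i_e ≤ (e+1)·i_{e+1}`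
      have hke' : k = e := by omega
      subst hke'
      have hT1 : T (k + 1) = 3 / 5 * (n.choose (k + 1) : ℚ) := by simp only [hT_def]; rw [if_neg (by omega)]
      have hT0 : T k = (n.choose k : ℚ) := by simp only [hT_def]; rw [if_pos le_rfl]
      rw [hT1, hT0]
      have hch := Nat.choose_succ_right_eq n k
      have hch' : (n.choose (k + 1) : ℚ) * ((k : ℚ) + 1) = (n.choose k : ℚ) * 5 := by
        have : n - k = 5 := by omega
        rw [this] at hch
        exact_mod_cast hch
      have hL := succ_mul_card_ge hs hG hrG (by omega) (j := k) (by omega)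
      rw [hd, show q + (k + 1) - q - k + 2 = 3 by omega] at hL
      have hL' : (3 : ℚ) * i k ≤ ((k : ℚ) + 1) * i (k + 1) := by
        simp only [hi_def]
        exact_mod_cast hL
      have hk1 : (0 : ℚ) < (k : ℚ) + 1 := by positivity
      have hc0 : (0 : ℚ) ≤ (n.choose k : ℚ) := by positivity
      have : i k * (3 / 5 * (n.choose (k + 1) : ℚ)) * ((k : ℚ) + 1) ≤
          i (k + 1) * (n.choose k : ℚ) * ((k : ℚ) + 1) := by
        calc i k * (3 / 5 * (n.choose (k + 1) : ℚ)) * ((k : ℚ) + 1)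
            = 3 / 5 * i k * ((n.choose (k + 1) : ℚ) * ((k : ℚ) + 1)) := by ring
          _ = 3 / 5 * i k * ((n.choose k : ℚ) * 5) := by rw [hch']
          _ = (n.choose k : ℚ) * (3 * i k) := by ring
          _ ≤ (n.choose k : ℚ) * (((k : ℚ) + 1) * i (k + 1)) := mul_le_mul_of_nonneg_left hL' hc0
          _ = i (k + 1) * (n.choose k : ℚ) * ((k : ℚ) + 1) := by ring
      exact le_of_mul_le_mul_right this hk1
  -- `g` is non-increasing
  have hg : ∀ j ∈ Finset.range (e + 1 + 1), ∀ k ∈ Finset.range (e + 1 + 1), j ≤ k → g k ≤ g j := by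
    intro j _ k _ hjk
    simp only [hg_def]
    have : (j : ℚ) ≤ (k : ℚ) := by exact_mod_cast hjk
    linarith
  have hcheb := ratio_profile_bound (e + 1) i T g hTpos hratio hg
  -- the profile sum is `σ′`
  have hprof : ∑ k ∈ Finset.range (e + 1 + 1), T k * g k =
      -(2 : ℚ) ^ (e + 1 + 4) + 2 / 5 * ((e + 1 + 4).choose 4 : ℚ) * (((e + 1 : ℕ) : ℚ) - 3) +
        ((e + 1 + 4).choose 3 : ℚ) * (((e + 1 : ℕ) : ℚ) - 1) + ((e + 1 + 4).choose 2 : ℚ) * (((e + 1 : ℕ) : ℚ) + 1) +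
        (((e + 1 : ℕ) : ℚ) + 4) * (((e + 1 : ℕ) : ℚ) + 3) + (((e + 1 : ℕ) : ℚ) + 5) := by
    -- split off the last term `k = e + 1`, the rest is the binomial sum up to `e`
    rw [Finset.sum_range_succ]
    have hlast : T (e + 1) * g (e + 1) = 3 / 5 * (n.choose (e + 1) : ℚ) * (((e + 1 : ℕ) : ℚ) + 3 - 2 * ((e + 1 : ℕ) : ℚ)) := by
      simp only [hT_def, hg_def]
      rw [if_neg (by omega)]
    have hrest : ∑ k ∈ Finset.range (e + 1), T k * g k = ∑ k ∈ Finset.range (e + 1), (n.choose k : ℚ) * g k := by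
      apply Finset.sum_congr rfl
      intro k hk
      have hk' := Finset.mem_range.1 hk
      simp only [hT_def]
      rw [if_pos (by omega)]
    rw [hlast, hrest]
    -- the full binomial sum over `range (n + 1)` equals `−2^n`; peel the five top terms
    have hfull := sum_range_choose_mul_sub n (((e + 1 : ℕ) : ℚ) + 3)
    have hfull' : ∑ k ∈ Finset.range (n + 1), (n.choose k : ℚ) * g k = -(2 : ℚ) ^ n := by
      rw [show (-(2 : ℚ) ^ n) = ((((e + 1 : ℕ) : ℚ) + 3) - (n : ℚ)) * 2 ^ n by
        rw [hn]; push_cast; ring]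
      rw [← hfull]
    have hn1 : n + 1 = e + 1 + 5 := by omega
    rw [hn1, Finset.sum_range_succ, Finset.sum_range_succ, Finset.sum_range_succ, Finset.sum_range_succ,
      Finset.sum_range_succ] at hfull'
    -- the binomial values of the peeled terms
    have b0 : n.choose (e + 1 + 4) = 1 := by rw [hn, show e + 1 + 4 = e + 5 by omega]; exact Nat.choose_self _
    have b1 : n.choose (e + 1 + 3) = e + 5 := by
      rw [hn, show e + 1 + 3 = e + 4 by omega]
      exact Nat.choose_succ_self_right (e + 4)
    have b2 : n.choose (e + 1 + 2) = (e + 1 + 4).choose 2 := by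
      rw [hn, show e + 5 = (e + 3) + 2 by omega, show e + 1 + 2 = e + 3 by omega, show e + 1 + 4 = e + 3 + 2 by omega]
      exact Nat.choose_symm_add
    have b3 : n.choose (e + 1 + 1) = (e + 1 + 4).choose 3 := by
      rw [hn, show e + 5 = (e + 2) + 3 by omega, show e + 1 + 1 = e + 2 by omega, show e + 1 + 4 = e + 2 + 3 by omega]
      exact Nat.choose_symm_add
    have b4 : n.choose (e + 1) = (e + 1 + 4).choose 4 := by
      rw [hn, show e + 5 = (e + 1) + 4 by omega, show e + 1 + 4 = e + 1 + 4 by omega]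
      exact Nat.choose_symm_add
    rw [b0, b1, b2, b3, b4] at hfull'
    rw [b4]
    simp only [hg_def] at hfull' ⊢
    push_cast at hfull' ⊢
    rw [hn] at hfull' ⊢
    linarith [hfull']
  have hsig := sigma_nonpos (e + 1) (by omega)
  have hprof' : ∑ k ∈ Finset.range (e + 1 + 1), T k * g k ≤ 0 := by
    rw [hprof]
    exact hsig
  have hTsum : 0 < ∑ k ∈ Finset.range (e + 1 + 1), T k :=
    Finset.sum_pos hTpos ⟨0, Finset.mem_range.2 (by omega)⟩
  have hisum : 0 ≤ ∑ k ∈ Finset.range (e + 1 + 1), i k :=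
    Finset.sum_nonneg (fun k _ => by simp only [hi_def]; positivity)
  have hneg : ∑ k ∈ Finset.range (e + 1 + 1), i k * g k ≤ 0 := by
    have h1 : (∑ k ∈ Finset.range (e + 1 + 1), i k) * (∑ k ∈ Finset.range (e + 1 + 1), T k * g k) ≤ 0 :=
      mul_nonpos_of_nonneg_of_nonpos hisum hprof'
    have h2 := hcheb.trans h1
    by_contra hpos
    push Not at hpos
    have := mul_pos hpos hTsum
    linarith
  have hDF : (0 : ℚ) ≤ ((q : ℚ) + 2) *
      ((((Rq M G q).filter (fun S : Finset α => (G \ S).card ≤ 2)).card : ℕ) : ℚ) := by positivity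
  rw [hsum]
  linarith

/-- **THEOREM G′ in the kernel**: on a simple matroid, `0 ≤ J_3(G)` for every rank-`q` set `G` with `4 ≤ q` all of
whose planes have `≤ 4` points (every subset of rank `≤ 3` has `≤ 4` points) — every corank. -/
theorem Jq_three_nonneg_of_planes (hs : Simple M) {G : Finset α} {q : ℕ} (hG : G ⊆ gr M)
    (hrG : M.eRk (G : Set α) = (q : ℕ∞)) (hq : 4 ≤ q)
    (hP : ∀ X ⊆ G, M.eRk (X : Set α) ≤ 3 → X.card ≤ 4) : 0 ≤ Jq M G q 3 := by
  have hqG : q ≤ G.card := le_card_of_eRk_eq hrG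
  rcases Nat.lt_or_ge G.card (q + 4) with h3 | h4
  · exact Jq_three_nonneg_of_card_le_add_three hs hG hrG hq (by omega)
  rcases Nat.lt_or_ge G.card (q + 5) with h4' | h5
  · exact Jq_three_nonneg_of_card_eq_add_four hs hG hrG hq (by omega)
  rcases Nat.lt_or_ge G.card (q + 6) with h5' | h6
  · exact Jq_three_nonneg_of_card_eq_add_five hs hG hrG hq (by omega)
  rcases Nat.lt_or_ge G.card (q + 7) with h6' | h7
  · exact Jq_three_nonneg_of_card_eq_add_six_of_planes hs hG hrG hq hP (by omega)
  rcases Nat.lt_or_ge G.card (q + 8) with h7' | h8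
  · exact Jq_three_nonneg_of_card_eq_add_seven_of_planes hs hG hrG hq hP (by omega)
  · exact Jq_three_nonneg_of_planes_of_add_eight_le hs hG hrG hq hP h8

end PercRepro.Star
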